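import Literature.NumberTheory.Automorphic.Liu2021.LemD1AsPrinted
import Literature.RepresentationTheory.TwistedCoinvariantsCentralCharacterQuotient
import Literature.NumberTheory.Automorphic.UnitaryGroupFinAdelicCenterLocal
import Literature.NumberTheory.Automorphic.QuadraticLocalBaseChange
import Literature.NumberTheory.Automorphic.AdicCompletionLocalField
import Mathlib.RingTheory.Etale.Field
import HarnessLib

/-!
# [Liu2021, App. D §D.1 / Lemma D.1] at a finite place of a quadratic extension of number fields

The file `Liu2021/LemD1AsPrinted.lean` types the data of [Liu2021, App. D §D.1] and Lemma D.1 (1) EXACTLY AS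
PRINTED over an abstract non-archimedean local field `F`, an étale `F`-algebra `E` of rank `2` and the tree's
standing data `OscillatorStandingData F E n` (`LemD1Data`, `LemD1_1AsPrinted`).  The tree's local Weil CARRIERS,
on the other hand, live on the concrete local model of a quadratic extension `E/F` of NUMBER FIELDS at a finite
place `v` of `F`:

* `F_v = v.adicCompletion F`, `E_v := E ⊗_F F_v = Π_{w ∣ v} E_w` (`UnitaryGroup.LocalRing E v`) with the
  conjugation `c ⊗ 1` (`UnitaryGroup.conjLocal E c v`);
* `U(J)(F_v)` in its factor form `UnitaryGroup.localPi E c N J v ≤ Π_{w ∣ v} GL_N(E_w)`;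
* the local centre `E_v¹ = U(J₁)(F_v) →* U(J)(F_v)`, `UnitaryGroup.localCenter E c N J J₁ hJ₁ v`
  (`J₁ = (j)`, `j ≠ 0`);
* a representation `ω` of `U(J)(F_v)` (e.g. the local Weil representation `𝓢.omegaLoc v` of
  `GelbartRogawski1991/FiniteAdelicSplittingAssembly.lean`), a character `χ` of `U(J₁)(F_v)`, and the maximal
  `χ`-quotient `TwistedCoinv.rep χ ω hc` on `Coinv (ω ∘ localCenter) χ`
  (`GelbartRogawski1991/FiniteAdelicWeilCentralCoinvariantsIrreducible.lean`, hypotheses `hirr`, `hadm`).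

This file is the JUNCTION between the two (the «local model»):

1. `LemD1OfPlace.standingData` — the tree's `OscillatorStandingData F_v E_v N` AT THE PLACE `v`: `conj := c ⊗ 1`
   as an `F_v`-algebra involution (`conjAlgEquiv`), `gram := J ⊗ 1` (literally the Gram matrix
   `(adelicForm E N J).map (adeleToLocal E v)` of `UnitaryGroup.«local»`, so that `standingData.U` and
   `UnitaryGroup.«local» E c N J v` have THE SAME membership condition, `mem_U_iff`), `E_v` étale of rank `2` over
   `F_v` (`formallyEtale_localRing`: base change `F_v ⊗_F E ≃ₐ E_v`, `baseChangeEquiv`), `ringChar F_v ≠ 2`,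
   `n = N ≥ 2`; for `J` hermitian (`(J.map c)ᵀ = J`) with `det J ≠ 0`.
2. `LemD1OfPlace.uEquiv : standingData.U ≃ₜ* localPi E c N J v` (regrouping `GL_N(Π_w E_w) = Π_w GL_N(E_w)`) and
   `LemD1OfPlace.theta : standingData.normOne →* localPi E c 1 J₁ v`, `z ↦ (z)` (onto, continuous), carrying the
   scalar centre `S.scalar : E_v¹ →* U(V)(F_v)` of the standing data to the tree's `localCenter`
   (`localCenter_theta`).
3. `LemD1OfPlace.data` — the as-printed `LemD1Data F_v E_v N V` whose ⟨CARRIER⟩ `omega` IS the given `ω` read on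
   `standingData.U` along `uEquiv`, whose Step-3 character is `χ ∘ theta`, with Step-1 representative `ε := δ ⊗ 1`
   (`c δ = -δ ≠ 0`) and a Step-2 character `μ` supplied by the caller (data + its three printed properties).
4. THE JUNCTION THEOREMS `LemD1OfPlace.isIrreducible_rep_of_lemD1_1AsPrinted`,
   `LemD1OfPlace.isAdmissible_rep_of_lemD1_1AsPrinted`, `LemD1OfPlace.nontrivial_coinv_of_lemD1_1AsPrinted`
   (the `TwistedCoinv` currency of `LocalOscillatorDatum.irreducibleAdmissible_ofCentralChar_iff_twistedCoinv`):
   [Liu2021, App. D Lemma D.1 (first sentence and (1))] AS PRINTED for the datum of 3., i.e. the hypothesis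
   `LemD1_1AsPrinted (LemD1OfPlace.data …)`, implies that `TwistedCoinv.rep χ ω hc` is ADMISSIBLE and — for
   `N ≥ 3` — IRREDUCIBLE and NON-ZERO: exactly the local hypotheses `hirr v`, `hadm v` of
   `FinLocalSplittings.omegaPi_centralCoinv_isIrreducible` at `H v = localPi E c 1 J₁ v`, `φ v = localCenter … v`.
   The proof is transport only: `quotRep = TwistedCoinv.rep` on the same group
   (`TwistedCoinvariantsCentralCharacterQuotient.lean`), pull-back of the `G`-action along the topological group
   isomorphism `uEquiv` and of the acting centre along the surjection `theta` (`TwistedCoinvariantsIrreducible.lean`),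
   admissibility along `uEquiv` by `Representation.IsAdmissible.of_equivariant_mulEquiv` (same file), §5 here.

Nothing is asserted about the Weil representation: `ω`, `μ`, `χ` are parameters, and Lemma D.1 (1) enters only as
the hypothesis `LemD1_1AsPrinted …` (a `Prop`, [Liu2021, App. D Lem. D.1]).  No `sorry`, no new axiom, no named fact.

References: [Liu2021] Y. Liu, *Fourier–Jacobi cycles and arithmetic relative trace formula*, Camb. J. Math. 9
(2021), arXiv:2102.11518, App. D §D.1 (l. 5209–5224), Lemma D.1 (l. 5226–5238); [Mok2014] C. P. Mok, *Endoscopic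
classification of representations of quasi-split unitary groups*, Mem. AMS 235 (2015), §1 Notation p. 5;
[CasselsFrohlichANT1967] Ch. II §10 (`L ⊗_K K_v = Π_{w∣v} L_w`); [BernsteinZelevinsky1976] Def. 2.1(b).
-/

noncomputable section

open scoped TensorProduct Matrix MatrixGroups
open NumberField IsDedekindDomain
open Literature.RepresentationTheory
open Literature.RepresentationTheory.Liu2021 (OscillatorStandingData)
open Literature.RepresentationTheory.CentralCharacterQuotient (augmentation quotRep)

namespace Literature.NumberTheory.Automorphic.Liu2021.LemD1OfPlace

open UnitaryGroup

variable {F : Type} (E : Type) [Field F] [NumberField F] [Field E] [NumberField E] [Algebra F E]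
  [Algebra.IsQuadraticExtension F E] (v : HeightOneSpectrum (𝓞 F))

/-! ## §1 `E_v = E ⊗_F F_v` as an étale `F_v`-algebra of rank `2` with involution `c ⊗ 1` -/

/-- `(c ⊗ 1) ∘ (c ⊗ 1) = id` on `E_v` (in the coordinates `E_v = F_v ⊕ F_v δ`, `c ⊗ 1` is `(a, b) ↦ (a, -b)`).
[cite: CasselsFrohlichANT1967, Ch. II §10] -/
theorem conjLocal_conjLocal_apply (c : E ≃ₐ[F] E) {δ : E} (hcδ : c δ = -δ) (hδ : δ ≠ 0) (x : LocalRing E v) :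
    conjLocal E c v (conjLocal E c v x) = x := by
  obtain ⟨⟨a, b⟩, rfl⟩ := (quadraticLocalEquiv E v c hcδ hδ).surjective x
  rw [conjLocal_quadraticLocalEquiv, conjLocal_quadraticLocalEquiv, neg_neg]

/-- **`c ⊗ 1` as an involutive `F_v`-algebra automorphism of `E_v`** (print's `c` at the place `v`).
[cite: Liu2021, App. D §D.1, arXiv:2102.11518 chunk p0056 L8 (arXiv PDF p. 76)] -/
def conjAlgEquiv (c : E ≃ₐ[F] E) {δ : E} (hcδ : c δ = -δ) (hδ : δ ≠ 0) :
    LocalRing E v ≃ₐ[v.adicCompletion F] LocalRing E v where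
  toFun := conjLocal E c v
  invFun := conjLocal E c v
  left_inv := conjLocal_conjLocal_apply E v c hcδ hδ
  right_inv := conjLocal_conjLocal_apply E v c hcδ hδ
  map_mul' := map_mul _
  map_add' := map_add _
  commutes' a := by
    change conjLocal E c v (toLocalRing E v a) = toLocalRing E v a
    exact conjLocal_toLocalRing c v a

/-- `conjAlgEquiv` is `c ⊗ 1` on elements. [cite: Liu2021, App. D §D.1, arXiv:2102.11518 chunk p0056 L8 (arXiv PDF p. 76)] -/
@[simp] theorem conjAlgEquiv_apply (c : E ≃ₐ[F] E) {δ : E} (hcδ : c δ = -δ) (hδ : δ ≠ 0) (x : LocalRing E v) :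
    conjAlgEquiv E v c hcδ hδ x = conjLocal E c v x := rfl

omit [NumberField F] [Algebra.IsQuadraticExtension F E] in
/-- `E → E_v = E ⊗_F F_v`, `e ↦ e ⊗ 1`, is an `F`-algebra homomorphism: `F → F_v → E_v` agrees with `F → E → E_v`.
[cite: CasselsFrohlichANT1967, Ch. II §10] -/
theorem algebraMap_algebraMap (x : F) :
    algebraMap E (LocalRing E v) (algebraMap F E x) = algebraMap F (LocalRing E v) x :=
  funext fun _ => rfl

/-- `E → E_v = E ⊗_F F_v`, `e ↦ e ⊗ 1`, as an `F`-algebra homomorphism. [cite: CasselsFrohlichANT1967, Ch. II §10] -/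
def ofField : E →ₐ[F] LocalRing E v :=
  { algebraMap E (LocalRing E v) with commutes' := algebraMap_algebraMap E v }

omit [NumberField F] [Algebra.IsQuadraticExtension F E] in
/-- `ofField e = e ⊗ 1`. [cite: CasselsFrohlichANT1967, Ch. II §10] -/
@[simp] theorem ofField_apply (e : E) : ofField E v e = algebraMap E (LocalRing E v) e := rfl

/-- **the base-change map `F_v ⊗_F E →ₐ[F_v] E_v`**, `a ⊗ e ↦ ι_v a · (e ⊗ 1)`. [cite: CasselsFrohlichANT1967, Ch. II §10] -/
def baseChangeHom : (v.adicCompletion F) ⊗[F] E →ₐ[v.adicCompletion F] LocalRing E v :=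
  Algebra.TensorProduct.lift (Algebra.ofId (v.adicCompletion F) (LocalRing E v)) (ofField E v)
    fun _ _ => Commute.all _ _

omit [Algebra.IsQuadraticExtension F E] in
/-- `baseChangeHom (a ⊗ e) = ι_v a · (e ⊗ 1)`. [cite: CasselsFrohlichANT1967, Ch. II §10] -/
@[simp] theorem baseChangeHom_tmul (a : v.adicCompletion F) (e : E) :
    baseChangeHom E v (a ⊗ₜ e) = toLocalRing E v a * algebraMap E (LocalRing E v) e := by
  rw [baseChangeHom, Algebra.TensorProduct.lift_tmul]
  rfl

/-- `baseChangeHom` is onto (`E_v = F_v ⊕ F_v δ`, `quadraticLocalEquiv`). [cite: CasselsFrohlichANT1967, Ch. II §10] -/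
theorem baseChangeHom_surjective : Function.Surjective (baseChangeHom E v) := fun x => by
  obtain ⟨σ, δ', hσδ, hδ'⟩ := exists_algEquiv_apply_eq_neg (F := F) (E := E)
  obtain ⟨⟨a, b⟩, rfl⟩ := (quadraticLocalEquiv E v σ hσδ hδ').surjective x
  refine ⟨a ⊗ₜ 1 + b ⊗ₜ δ', ?_⟩
  rw [map_add, baseChangeHom_tmul, baseChangeHom_tmul, quadraticLocalEquiv_apply, map_one, mul_one]

/-- `baseChangeHom` is bijective (onto, between `F_v`-spaces of the same dimension `2 = [E : F]`).
[cite: CasselsFrohlichANT1967, Ch. II §10] -/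
theorem baseChangeHom_bijective : Function.Bijective (baseChangeHom E v) := by
  haveI : Module.Finite F E := Module.finite_of_finrank_eq_succ (Algebra.IsQuadraticExtension.finrank_eq_two F E)
  refine ⟨?_, baseChangeHom_surjective E v⟩
  have hfin : Module.finrank (v.adicCompletion F) ((v.adicCompletion F) ⊗[F] E) =
      Module.finrank (v.adicCompletion F) (LocalRing E v) := by
    rw [Module.finrank_baseChange, finrank_localRing E v, Algebra.IsQuadraticExtension.finrank_eq_two F E]
  exact (LinearMap.injective_iff_surjective_of_finrank_eq_finrank hfin
    (f := (baseChangeHom E v).toLinearMap)).2 (baseChangeHom_surjective E v)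

/-- **`E ⊗_F F_v ≅ Π_{w ∣ v} E_w`** as `F_v`-algebras (Cassels–Fröhlich II §10), base-change form.
[cite: CasselsFrohlichANT1967, Ch. II §10] -/
def baseChangeEquiv : (v.adicCompletion F) ⊗[F] E ≃ₐ[v.adicCompletion F] LocalRing E v :=
  AlgEquiv.ofBijective (baseChangeHom E v) (baseChangeHom_bijective E v)

/-- **`E_v` is an étale `F_v`-algebra** («étale `F`-algebra of rank 2», [Liu2021, App. D §D.1 l. 5213]): base change of
the separable extension `E/F`. [cite: Liu2021, App. D §D.1, arXiv:2102.11518 chunk p0056 L8 (arXiv PDF p. 76)] -/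
theorem formallyEtale_localRing : Algebra.FormallyEtale (v.adicCompletion F) (LocalRing E v) := by
  haveI : Module.Finite F E := Module.finite_of_finrank_eq_succ (Algebra.IsQuadraticExtension.finrank_eq_two F E)
  haveI : Algebra.FormallyEtale F E := Algebra.FormallyEtale.of_isSeparable F E
  exact Algebra.FormallyEtale.of_equiv (baseChangeEquiv E v)

/-- **`E_v` carries the module topology over `F_v`** (the product topology of `Π_w E_w` is the canonical topology of
the `2`-dimensional `F_v`-space `F_v ⊕ F_v δ`, `quadraticLocalEquiv`). [cite: CasselsFrohlichANT1967, Ch. II §10] -/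
theorem isModuleTopology_localRing : IsModuleTopology (v.adicCompletion F) (LocalRing E v) := by
  obtain ⟨σ, δ', hσδ, hδ'⟩ := exists_algEquiv_apply_eq_neg (F := F) (E := E)
  exact IsModuleTopology.iso (quadraticLocalEquiv E v σ hσδ hδ')

/-! ## §2 The standing data of [Liu2021, App. D §D.1] at the place `v` -/

variable (c : E ≃ₐ[F] E) (N : ℕ) (J : Matrix (Fin N) (Fin N) E)

omit [NumberField F] [Algebra.IsQuadraticExtension F E] in
/-- the local Gram matrix of `UnitaryGroup.«local»` is `J ⊗ 1`. [cite: Mok2014, §1 Notation p. 5] -/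
theorem localGram_eq : (adelicForm E N J).map (adeleToLocal E v) = J.map (algebraMap E (LocalRing E v)) := by
  rw [adelicForm, Matrix.map_map]
  rfl

omit [Algebra.IsQuadraticExtension F E] in
/-- `J ⊗ 1` is hermitian for `c ⊗ 1` when `J` is hermitian for `c`. [cite: Mok2014, §1 Notation p. 5] -/
theorem localGram_hermitian (hJh : (J.map c)ᵀ = J) :
    (((adelicForm E N J).map (adeleToLocal E v)).map (conjLocal E c v))ᵀ = (adelicForm E N J).map (adeleToLocal E v) := by
  have h1 : ((adelicForm E N J).map (adeleToLocal E v)).map (conjLocal E c v) =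
      (J.map c).map (algebraMap E (LocalRing E v)) := by
    rw [localGram_eq, Matrix.map_map, Matrix.map_map]
    exact Matrix.ext fun i j => conjLocal_algebraMap c v (J i j)
  rw [h1, ← Matrix.transpose_map, hJh, localGram_eq]

omit [NumberField F] [Algebra.IsQuadraticExtension F E] in
/-- `det (J ⊗ 1) = det J ⊗ 1` is a unit when `det J ≠ 0`. [cite: Mok2014, §1 Notation p. 5] -/
theorem isUnit_det_localGram (hJdet : J.det ≠ 0) : IsUnit ((adelicForm E N J).map (adeleToLocal E v)).det := by
  rw [localGram_eq, ← RingHom.mapMatrix_apply, ← RingHom.map_det]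
  exact hJdet.isUnit.map _

omit [Algebra.IsQuadraticExtension F E] in
/-- `F_v` has characteristic `0 ≠ 2`. [cite: Liu2021, App. D §D.1, arXiv:2102.11518 chunk p0056 L8 (arXiv PDF p. 76)] -/
theorem ringChar_adicCompletion_ne_two : ringChar (v.adicCompletion F) ≠ 2 := by
  haveI : CharZero (v.adicCompletion F) :=
    charZero_of_injective_algebraMap (algebraMap F (v.adicCompletion F)).injective
  rw [ringChar.eq_zero]
  decide

/-- `c ⊗ 1 ≠ id` (it negates `δ ⊗ 1 ≠ 0`). [cite: Liu2021, App. D §D.1, arXiv:2102.11518 chunk p0056 L8 (arXiv PDF p. 76)] -/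
theorem conjAlgEquiv_ne_refl {δ : E} (hcδ : c δ = -δ) (hδ : δ ≠ 0) : conjAlgEquiv E v c hcδ hδ ≠ AlgEquiv.refl := by
  intro h
  have h1 : conjLocal E c v (algebraMap E (LocalRing E v) δ) = algebraMap E (LocalRing E v) δ :=
    AlgEquiv.congr_fun h (algebraMap E (LocalRing E v) δ)
  rw [conjLocal_algebraMap, hcδ, map_neg] at h1
  exact hδ (CharZero.neg_eq_self_iff.1 ((algebraMap E (LocalRing E v)).injective (by rw [map_neg]; exact h1)))

/-- **[Liu2021, App. D §D.1]'s standing data AT THE FINITE PLACE `v` of the quadratic extension `E/F` of number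
fields**, on the tree's local model: `F := F_v`, `E := E_v = Π_{w∣v} E_w`, `c := c ⊗ 1`, the hermitian space
`(E_vᴺ, J ⊗ 1)` (Gram matrix literally that of `UnitaryGroup.«local» E c N J v`), `ringChar F_v = 0 ≠ 2`, `E_v`
étale of rank `2`, `N ≥ 2`; for `J` hermitian (`(Jᶜ)ᵀ = J`) and non-degenerate. [cite: Liu2021, App. D §D.1, arXiv:2102.11518 chunk p0056 L8 (arXiv PDF p. 76)] -/
def standingData {δ : E} (hcδ : c δ = -δ) (hδ : δ ≠ 0) (hN : 2 ≤ N) (hJh : (J.map c)ᵀ = J) (hJdet : J.det ≠ 0) :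
    OscillatorStandingData (v.adicCompletion F) (LocalRing E v) N where
  conj := conjAlgEquiv E v c hcδ hδ
  conj_conj := conjLocal_conjLocal_apply E v c hcδ hδ
  conj_ne_refl := conjAlgEquiv_ne_refl E v c hcδ hδ
  gram := (adelicForm E N J).map (adeleToLocal E v)
  gram_hermitian := localGram_hermitian E v c N J hJh
  isUnit_det_gram := isUnit_det_localGram E v N J hJdet
  ringChar_ne_two := ringChar_adicCompletion_ne_two v
  formallyEtale := formallyEtale_localRing E v
  finrank_eq_two := finrank_localRing E v
  two_le := hN

variable {δ : E} (hcδ : c δ = -δ) (hδ : δ ≠ 0) (hN : 2 ≤ N) (hJh : (J.map c)ᵀ = J) (hJdet : J.det ≠ 0)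

/-- unfolding: the involution of the standing data is `c ⊗ 1`. [cite: Liu2021, App. D §D.1, arXiv:2102.11518 chunk p0056 L8 (arXiv PDF p. 76)] -/
@[simp] theorem standingData_conj_apply (x : LocalRing E v) :
    (standingData E v c N J hcδ hδ hN hJh hJdet).conj x = conjLocal E c v x := rfl

/-- unfolding: the Gram matrix of the standing data is that of `UnitaryGroup.«local» E c N J v`.
[cite: Mok2014, §1 Notation p. 5] -/
@[simp] theorem standingData_gram :
    (standingData E v c N J hcδ hδ hN hJh hJdet).gram = (adelicForm E N J).map (adeleToLocal E v) := rfl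

/-- norm-one elements of the standing data: `z · (c ⊗ 1) z = 1`. [cite: Liu2021, App. D §D.1, arXiv:2102.11518 chunk p0056 L8 (arXiv PDF p. 76)] -/
theorem mul_conjLocal_eq_one (z : (standingData E v c N J hcδ hδ hN hJh hJdet).normOne) :
    (((z : (LocalRing E v)ˣ) : LocalRing E v)) * conjLocal E c v ((z : (LocalRing E v)ˣ) : LocalRing E v) = 1 :=
  ((standingData E v c N J hcδ hδ hN hJh hJdet).mem_normOne_iff' z).1 z.2

/-- **`U(V)(F_v)` of the standing data and the tree's `U(J)(F_v) ≤ GL_N(E_v)` have the same members**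
(both: `((c ⊗ 1) g)ᵀ (J ⊗ 1) g = J ⊗ 1`). [cite: Mok2014, §1 Notation p. 5] -/
theorem mem_U_iff (g : GL (Fin N) (LocalRing E v)) :
    g ∈ (standingData E v c N J hcδ hδ hN hJh hJdet).U ↔ g ∈ «local» E c N J v := by
  rw [OscillatorStandingData.mem_U_iff, «local», mem_unitaryGroupOfForm_iff]
  exact Iff.rfl

/-- **`U(V)(F_v) ≃ₜ* UnitaryGroup.localPi E c N J v`**: the standing data's unitary group in the tree's factor form
`≤ Π_{w ∣ v} GL_N(E_w)` (regrouping `GL_N(Π_w E_w) = Π_w GL_N(E_w)`, `localGLPiEquiv`). [cite: PlatonovRapinchuk1994, §5.1] -/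
def uEquiv : (standingData E v c N J hcδ hδ hN hJh hJdet).U ≃ₜ* localPi E c N J v where
  toFun u := ⟨localGLPiEquiv E N v u.1,
    (localGLPiEquiv_mem_localPi_iff E c N J v u.1).2 ((mem_U_iff E v c N J hcδ hδ hN hJh hJdet u.1).1 u.2)⟩
  invFun g := ⟨(localGLPiEquiv E N v).symm g.1,
    (mem_U_iff E v c N J hcδ hδ hN hJh hJdet _).2 ((mem_localPi_iff_symm_mem E c N J v g.1).1 g.2)⟩
  left_inv u := Subtype.ext ((localGLPiEquiv E N v).symm_apply_apply u.1)
  right_inv g := Subtype.ext ((localGLPiEquiv E N v).apply_symm_apply g.1)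
  map_mul' _ _ := Subtype.ext (map_mul _ _ _)
  continuous_toFun := ((localGLPiEquiv E N v).continuous.comp continuous_subtype_val).subtype_mk _
  continuous_invFun := ((localGLPiEquiv E N v).symm.continuous.comp continuous_subtype_val).subtype_mk _

/-- underlying families: `uEquiv u = localGLPiEquiv u`. [cite: PlatonovRapinchuk1994, §5.1] -/
@[simp] theorem coe_uEquiv_apply (u : (standingData E v c N J hcδ hδ hN hJh hJdet).U) :
    ((uEquiv E v c N J hcδ hδ hN hJh hJdet u : localPi E c N J v) : LocalGLPi E N v) = localGLPiEquiv E N v u.1 :=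
  rfl

/-! ## §3 The centre: `E_v¹ = S.normOne` onto `U(J₁)(F_v)`, compatibly with `S.scalar` and `localCenter` -/

variable (J₁ : Matrix (Fin 1) (Fin 1) E)

omit [Algebra.IsQuadraticExtension F E] in
/-- a scalar `z ∈ E_v` with `z · zᶜ = 1` lies in `U(J₁)(F_v) ≤ GL_1(E_v)` for every `J₁`. [cite: Mok2014, §1 Notation p. 5] -/
theorem unitScalar_mem_local (z : (LocalRing E v)ˣ) (hz : (z : LocalRing E v) * conjLocal E c v z = 1) :
    OscillatorStandingData.unitScalar (E := LocalRing E v) 1 z ∈ «local» E c 1 J₁ v :=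
  scalar_mem_unitaryGroupOfForm (conjLocal E c v) _ z (by rw [mul_comm]; exact hz)

/-- the underlying map of `θ`: `z ↦ (z)` regrouped in `Π_w GL_1(E_w)`. [cite: Mok2014, §1 Notation p. 5] -/
def thetaFun (z : (standingData E v c N J hcδ hδ hN hJh hJdet).normOne) : localPi E c 1 J₁ v :=
  ⟨localGLPiEquiv E 1 v (OscillatorStandingData.unitScalar (E := LocalRing E v) 1 (z : (LocalRing E v)ˣ)),
    (localGLPiEquiv_mem_localPi_iff E c 1 J₁ v _).2
      (unitScalar_mem_local E v c J₁ _ (mul_conjLocal_eq_one E v c N J hcδ hδ hN hJh hJdet z))⟩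

/-- **`θ : E_v¹ →* U(J₁)(F_v)`**, `z ↦ (z)`: the norm-one scalars of the standing data (`S.normOne ≤ E_vˣ`) as
elements of the tree's `localPi E c 1 J₁ v`. [cite: Mok2014, §1 Notation p. 5] -/
def theta : (standingData E v c N J hcδ hδ hN hJh hJdet).normOne →* localPi E c 1 J₁ v :=
  MonoidHom.mk' (thetaFun E v c N J hcδ hδ hN hJh hJdet J₁) fun z w => by
    apply Subtype.ext
    change localGLPiEquiv E 1 v (OscillatorStandingData.unitScalar (E := LocalRing E v) 1
        ((z * w : (standingData E v c N J hcδ hδ hN hJh hJdet).normOne) : (LocalRing E v)ˣ)) =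
      localGLPiEquiv E 1 v (OscillatorStandingData.unitScalar (E := LocalRing E v) 1 (z : (LocalRing E v)ˣ)) *
        localGLPiEquiv E 1 v (OscillatorStandingData.unitScalar (E := LocalRing E v) 1 (w : (LocalRing E v)ˣ))
    rw [Subgroup.coe_mul, map_mul, map_mul]

/-- underlying family of `θ z`: the regrouped scalar matrix `(z)`. [cite: Mok2014, §1 Notation p. 5] -/
theorem coe_theta (z : (standingData E v c N J hcδ hδ hN hJh hJdet).normOne) :
    ((theta E v c N J hcδ hδ hN hJh hJdet J₁ z : localPi E c 1 J₁ v) : LocalGLPi E 1 v) =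
      localGLPiEquiv E 1 v (OscillatorStandingData.unitScalar (E := LocalRing E v) 1 (z : (LocalRing E v)ˣ)) :=
  rfl

/-- the `w`-component matrix of `θ z` is the `1 × 1` matrix `(z_w)`. [cite: Mok2014, §1 Notation p. 5] -/
theorem coe_theta_apply (z : (standingData E v c N J hcδ hδ hN hJh hJdet).normOne) (w : PlacesOver E v) :
    ((((theta E v c N J hcδ hδ hN hJh hJdet J₁ z : localPi E c 1 J₁ v) : LocalGLPi E 1 v) w :
        GL (Fin 1) (w.1.adicCompletion E)) : Matrix (Fin 1) (Fin 1) (w.1.adicCompletion E)) =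
      Matrix.diagonal fun _ => ((z : (LocalRing E v)ˣ) : LocalRing E v) w := by
  change ((OscillatorStandingData.unitScalar (E := LocalRing E v) 1 (z : (LocalRing E v)ˣ) :
      GL (Fin 1) (LocalRing E v)) : Matrix (Fin 1) (Fin 1) (LocalRing E v)).map (Pi.evalRingHom _ w) = _
  rw [OscillatorStandingData.coe_unitScalar, Matrix.scalar_apply, Matrix.diagonal_map (map_zero _)]
  rfl

/-- `θ` is continuous. [cite: Mok2014, §1 Notation p. 5] -/
theorem continuous_theta : Continuous (theta E v c N J hcδ hδ hN hJh hJdet J₁) := by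
  have hsc : Continuous (OscillatorStandingData.unitScalar (E := LocalRing E v) 1) := by
    refine Units.continuous_map ?_
    change Continuous fun a : LocalRing E v => Matrix.scalar (Fin 1) a
    simp_rw [Matrix.scalar_apply]
    exact (continuous_pi fun _ => continuous_id).matrix_diagonal
  exact (((localGLPiEquiv E 1 v).continuous.comp hsc).comp continuous_subtype_val).subtype_mk _

/-- **`θ` is onto**: an element of `U(J₁)(F_v) ≤ GL_1(E_v)` is a scalar `(z)` with `zᶜ j z = j`, `j = J₁ 0 0 ≠ 0`,
i.e. `z zᶜ = 1`. [cite: Mok2014, §1 Notation p. 5] -/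
theorem theta_surjective (hJ₁ : J₁ 0 0 ≠ 0) : Function.Surjective (theta E v c N J hcδ hδ hN hJh hJdet J₁) := by
  intro g
  obtain ⟨g', rfl⟩ := (localPiEquiv E c 1 J₁ v).symm.surjective g
  -- the unitary relation of `g' ∈ U(J₁)(F_v) ≤ GL_1(E_v)` at the entry `(0, 0)`
  have hmem : (((g'.1 : GL (Fin 1) (LocalRing E v)) : Matrix (Fin 1) (Fin 1) (LocalRing E v)).map
      (conjLocal E c v))ᵀ * J₁.map (algebraMap E (LocalRing E v)) *
        ((g'.1 : GL (Fin 1) (LocalRing E v)) : Matrix (Fin 1) (Fin 1) (LocalRing E v)) =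
      J₁.map (algebraMap E (LocalRing E v)) := by
    have h : (g'.1 : GL (Fin 1) (LocalRing E v)) ∈
        unitaryGroupOfForm (conjLocal E c v) ((adelicForm E 1 J₁).map (adeleToLocal E v)) := g'.2
    rw [mem_unitaryGroupOfForm_iff, localGram_eq] at h
    exact h
  have h00 := congrFun (congrFun hmem 0) 0
  simp only [Matrix.mul_apply, Fin.sum_univ_one, Matrix.transpose_apply, Matrix.map_apply] at h00
  -- `j = J₁ 0 0 ⊗ 1` is a unit of `E_v`, so `zᶜ z = 1` for `z = g'₀₀`
  have hj : IsUnit (algebraMap E (LocalRing E v) (J₁ 0 0)) := hJ₁.isUnit.map _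
  have hzz : conjLocal E c v (((g'.1 : GL (Fin 1) (LocalRing E v)) : Matrix (Fin 1) (Fin 1) (LocalRing E v)) 0 0) *
      ((g'.1 : GL (Fin 1) (LocalRing E v)) : Matrix (Fin 1) (Fin 1) (LocalRing E v)) 0 0 = 1 := by
    refine hj.mul_right_cancel ?_
    rw [one_mul, mul_right_comm]
    exact h00
  -- the unit `z = det g' = g'₀₀`
  have hdet : ((Matrix.GeneralLinearGroup.det (g'.1 : GL (Fin 1) (LocalRing E v)) : (LocalRing E v)ˣ) :
      LocalRing E v) = ((g'.1 : GL (Fin 1) (LocalRing E v)) : Matrix (Fin 1) (Fin 1) (LocalRing E v)) 0 0 := by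
    rw [Matrix.GeneralLinearGroup.val_det_apply, Matrix.det_fin_one]
  have hz : Matrix.GeneralLinearGroup.det (g'.1 : GL (Fin 1) (LocalRing E v)) ∈
      (standingData E v c N J hcδ hδ hN hJh hJdet).normOne := by
    rw [OscillatorStandingData.mem_normOne_iff', hdet, standingData_conj_apply, mul_comm]
    exact hzz
  refine ⟨⟨_, hz⟩, Subtype.ext ?_⟩
  rw [coe_theta, coe_localPiEquiv_symm_apply]
  congr 1
  refine Units.ext ?_
  rw [OscillatorStandingData.coe_unitScalar]
  refine Matrix.ext fun i j => ?_
  rw [Subsingleton.elim i 0, Subsingleton.elim j 0, Matrix.scalar_apply, Matrix.diagonal_apply_eq]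
  exact hdet

/-- **the two centres agree**: `localCenter (θ z) = uEquiv (S.scalar z)` — the tree's local centre
`U(J₁)(F_v) →* U(J)(F_v)`, `(z) ↦ z · 1_N`, is print's scalar embedding `E_v¹ ↪ U(V)(F_v)` of the standing data.
[cite: Liu2021, App. D §D.1 Step 3, arXiv:2102.11518 chunk p0056 L16 (arXiv PDF p. 76)] -/
theorem localCenter_theta (hJ₁ : J₁ 0 0 ≠ 0) (z : (standingData E v c N J hcδ hδ hN hJh hJdet).normOne) :
    localCenter E c N J J₁ hJ₁ v (theta E v c N J hcδ hδ hN hJh hJdet J₁ z) =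
      uEquiv E v c N J hcδ hδ hN hJh hJdet ((standingData E v c N J hcδ hδ hN hJh hJdet).scalar z) := by
  refine Subtype.ext (funext fun w => Units.ext ?_)
  change ((localScalarGL E N v ((theta E v c N J hcδ hδ hN hJh hJdet J₁ z : localPi E c 1 J₁ v) :
      LocalGLPi E 1 v) w : GL (Fin N) (w.1.adicCompletion E)) : Matrix (Fin N) (Fin N) (w.1.adicCompletion E)) =
    ((OscillatorStandingData.unitScalar (E := LocalRing E v) N (z : (LocalRing E v)ˣ) : GL (Fin N) (LocalRing E v)) :
      Matrix (Fin N) (Fin N) (LocalRing E v)).map (Pi.evalRingHom _ w)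
  rw [coe_localScalarGL_apply, coe_theta_apply, Matrix.diagonal_apply_eq, Matrix.smul_one_eq_diagonal,
    OscillatorStandingData.coe_unitScalar, Matrix.scalar_apply, Matrix.diagonal_map (map_zero _)]
  rfl

/-! ## §4 The as-printed datum `LemD1Data F_v E_v N V` on a representation of `UnitaryGroup.localPi` -/

variable {V : Type} [AddCommGroup V] [Module ℂ V] (ω : Representation ℂ (localPi E c N J v) V)
  (μ : (LocalRing E v)ˣ →* ℂˣ) (hμn : ∀ x, ‖((μ x : ℂˣ) : ℂ)‖ = 1) (hμc : Continuous fun x => ((μ x : ℂˣ) : ℂ))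
  (hμF : ∀ a : (v.adicCompletion F)ˣ,
    μ (Units.map (algebraMap (v.adicCompletion F) (LocalRing E v)).toMonoidHom a) = 1 ↔
      ∃ x : (LocalRing E v)ˣ, (x : LocalRing E v) * conjLocal E c v x =
        algebraMap (v.adicCompletion F) (LocalRing E v) a)
  (χ : localPi E c 1 J₁ v →* ℂˣ) (hχn : ∀ h, ‖((χ h : ℂˣ) : ℂ)‖ = 1) (hχc : Continuous fun h => ((χ h : ℂˣ) : ℂ))

/-- Step 1's representative at `v`: `ε := δ ⊗ 1`, a unit of `E_v` (`δ ≠ 0`). [cite: Liu2021, App. D §D.1 Step 1 (l. 5217)] -/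
def eps : (LocalRing E v)ˣ := Units.map (algebraMap E (LocalRing E v)).toMonoidHom (Units.mk0 δ hδ)

/-- `ε + εᶜ = 0` (`c δ = -δ`): `ε ∈ E_v⁻ = S.skew`. [cite: Liu2021, App. D §D.1 Step 1 (l. 5217)] -/
theorem eps_mem_skew : ((eps E v hδ : (LocalRing E v)ˣ) : LocalRing E v) ∈ (standingData E v c N J hcδ hδ hN hJh hJdet).skew := by
  rw [OscillatorStandingData.mem_skew_iff]
  change algebraMap E (LocalRing E v) δ + conjLocal E c v (algebraMap E (LocalRing E v) δ) = 0
  rw [conjLocal_algebraMap, hcδ, map_neg, add_neg_cancel]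

/-- **The data of [Liu2021, App. D §D.1 + Lemma D.1] at the place `v` on a given representation `ω` of
`U(J)(F_v) = UnitaryGroup.localPi E c N J v`**: `F := F_v` («nonarchimedean», Mathlib), `E := E_v` with its module
topology, `S := standingData` (§2), Step 1's representative `ε := δ ⊗ 1 ∈ E_v^{−×}` (`c δ = -δ ≠ 0`), Step 2's
`μ` (the caller's choice, with its three printed properties), Step 3's `χ := χ ∘ θ` for a character `χ` of
`U(J₁)(F_v)` (§3), and the ⟨CARRIER⟩ `omega := ω ∘ uEquiv` — the given `ω` read on `U(V)(F_v) = S.U`.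
[cite: Liu2021, App. D §D.1 (l. 5213–5224), arXiv:2102.11518 chunk p0056 L8–L16 (arXiv PDF p. 76)] -/
def data : LemD1Data (v.adicCompletion F) (LocalRing E v) N V where
  isNonarchimedeanLocalField := inferInstance
  isModuleTopology := isModuleTopology_localRing E v
  S := standingData E v c N J hcδ hδ hN hJh hJdet
  eps := eps E v hδ
  eps_mem_skew := eps_mem_skew E v c N J hcδ hδ hN hJh hJdet
  mu := μ
  norm_mu := hμn
  continuous_mu := hμc
  mu_algebraMap_eq_one_iff := hμF
  chi := χ.comp (theta E v c N J hcδ hδ hN hJh hJdet J₁)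
  norm_chi _ := hχn _
  continuous_chi := hχc.comp (continuous_theta E v c N J hcδ hδ hN hJh hJdet J₁)
  omega := ω.comp (uEquiv E v c N J hcδ hδ hN hJh hJdet).toMulEquiv.toMonoidHom

/-- unfolding: the standing data of `data` is `standingData`. [cite: Liu2021, App. D §D.1, arXiv:2102.11518 chunk p0056 L8 (arXiv PDF p. 76)] -/
@[simp] theorem data_S : (data E v c N J hcδ hδ hN hJh hJdet J₁ ω μ hμn hμc hμF χ hχn hχc).S =
    standingData E v c N J hcδ hδ hN hJh hJdet := rfl

/-- unfolding: `omega = ω ∘ uEquiv`. [cite: Liu2021, App. D §D.1 Steps 1–2, arXiv:2102.11518 chunk p0056 L12–L14 (arXiv PDF p. 76)] -/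
theorem data_omega_apply (g : (standingData E v c N J hcδ hδ hN hJh hJdet).U) :
    (data E v c N J hcδ hδ hN hJh hJdet J₁ ω μ hμn hμc hμF χ hχn hχc).omega g =
      ω (uEquiv E v c N J hcδ hδ hN hJh hJdet g) := rfl

/-- unfolding: `chi = χ ∘ θ`. [cite: Liu2021, App. D §D.1 Step 3, arXiv:2102.11518 chunk p0056 L16 (arXiv PDF p. 76)] -/
theorem data_chi_apply (z : (standingData E v c N J hcδ hδ hN hJh hJdet).normOne) :
    (data E v c N J hcδ hδ hN hJh hJdet J₁ ω μ hμn hμc hμF χ hχn hχc).chi z =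
      χ (theta E v c N J hcδ hδ hN hJh hJdet J₁ z) := rfl

/-- unfolding: `mu = μ`. [cite: Liu2021, App. D §D.1 Step 2, arXiv:2102.11518 chunk p0056 L14 (arXiv PDF p. 76)] -/
@[simp] theorem data_mu : (data E v c N J hcδ hδ hN hJh hJdet J₁ ω μ hμn hμc hμF χ hχn hχc).mu = μ := rfl

/-- unfolding: `eps = δ ⊗ 1`. [cite: Liu2021, App. D §D.1 Step 1, arXiv:2102.11518 chunk p0056 L12 (arXiv PDF p. 76)] -/
@[simp] theorem data_eps : (data E v c N J hcδ hδ hN hJh hJdet J₁ ω μ hμn hμc hμF χ hχn hχc).eps = eps E v hδ := rfl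

/-! ## §5 Transport lemmas (abstract): the acting group along a surjection, the `G`-action along `≃ₜ*` -/

section Transport

variable {k : Type*} [Field k] {G G' H H' S : Type*} [Group G] [Group G'] [Group H] [Group H']
  [AddCommGroup S] [Module k S] [TopologicalSpace G] [TopologicalSpace G']

/-- **Pulling the acting group back along a SURJECTIVE `ζ : H' →* H` does not change admissibility of the `G`-action
on the coinvariants** (`Coinv (ρW ∘ ζ) (χ ∘ ζ)` and `Coinv ρW χ` are the quotients by the same submodule,
`TwistedCoinv.ker_comp_of_surjective`). [cite: BernsteinZelevinsky1976, Definition 2.1(b)] -/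
theorem isAdmissible_rep_iff_of_comp_surjective_right (ρW : Representation k H S) (χ : H →* kˣ) (ζ : H' →* H)
    (hζ : Function.Surjective ζ) (ρV : Representation k G S) (hc : ∀ (g : G) (h : H), Commute (ρV g) (ρW h))
    (hc' : ∀ (g : G) (h' : H'), Commute (ρV g) ((show Representation k H' S from ρW.comp ζ) h')) :
    (TwistedCoinv.rep (χ.comp ζ) ρV hc').IsAdmissible ↔ (TwistedCoinv.rep χ ρV hc).IsAdmissible :=
  Representation.isAdmissible_iff_of_equivariant _ _
    (Submodule.quotEquivOfEq _ _ (TwistedCoinv.ker_comp_of_surjective ρW χ ζ hζ)) fun g x => by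
      obtain ⟨v, rfl⟩ := TwistedCoinv.mk_surjective _ (χ.comp ζ) x
      rfl

omit [TopologicalSpace G] in
/-- likewise for non-vanishing of the coinvariants. [cite: Liu2021, App. D §D.1 Step 3 (l. 5221)] -/
theorem nontrivial_coinv_iff_of_comp_surjective_right (ρW : Representation k H S) (χ : H →* kˣ) (ζ : H' →* H)
    (hζ : Function.Surjective ζ) :
    Nontrivial (TwistedCoinv.Coinv (show Representation k H' S from ρW.comp ζ) (χ.comp ζ)) ↔
      Nontrivial (TwistedCoinv.Coinv ρW χ) :=
  (Submodule.quotEquivOfEq _ _ (TwistedCoinv.ker_comp_of_surjective ρW χ ζ hζ)).toEquiv.nontrivial_congr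

/-- **Pulling the `G`-action back along a topological group ISOMORPHISM `f : G' ≃ₜ* G` preserves and reflects
admissibility of the coinvariant representation** (`Representation.IsAdmissible.of_equivariant_mulEquiv` with the
identity of the space, `TwistedCoinv.rep_comp_apply`). [cite: BernsteinZelevinsky1976, Definition 2.1(b)] -/
theorem isAdmissible_rep_comp_iff_of_continuousMulEquiv (ρW : Representation k H S) (χ : H →* kˣ)
    (ρV : Representation k G S) (hc : ∀ (g : G) (h : H), Commute (ρV g) (ρW h)) (f : G' ≃ₜ* G)
    (hc' : ∀ (g' : G') (h : H),
      Commute ((show Representation k G' S from ρV.comp f.toMulEquiv.toMonoidHom) g') (ρW h)) :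
    (TwistedCoinv.rep χ (show Representation k G' S from ρV.comp f.toMulEquiv.toMonoidHom) hc').IsAdmissible ↔
      (TwistedCoinv.rep χ ρV hc).IsAdmissible := by
  constructor
  · intro h
    exact Representation.IsAdmissible.of_equivariant_mulEquiv _ f (LinearEquiv.refl k _)
      (fun g' x => by
        rw [LinearEquiv.refl_apply, LinearEquiv.refl_apply,
          TwistedCoinv.rep_comp_apply ρW χ ρV hc f.toMulEquiv.toMonoidHom hc']
        rfl) h
  · intro h
    exact Representation.IsAdmissible.of_equivariant_mulEquiv _ f.symm (LinearEquiv.refl k _)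
      (fun g x => by
        rw [LinearEquiv.refl_apply, LinearEquiv.refl_apply,
          TwistedCoinv.rep_comp_apply ρW χ ρV hc f.toMulEquiv.toMonoidHom hc']
        change _ = TwistedCoinv.rep χ ρV hc (f (f.symm g)) x
        rw [ContinuousMulEquiv.apply_symm_apply]) h

end Transport

/-! ## §6 The junction: Lemma D.1 (1) as printed ⟹ the tree's local hypotheses `hirr`, `hadm` -/

variable (hJ₁ : J₁ 0 0 ≠ 0)
  (hc : ∀ (g : localPi E c N J v) (h : localPi E c 1 J₁ v),
    Commute (ω g) ((show Representation ℂ (localPi E c 1 J₁ v) V from ω.comp (localCenter E c N J J₁ hJ₁ v)) h))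

include hc in
/-- the commuting hypothesis for the pair `(ω, ω ∘ localCenter ∘ θ)` on `V`. [cite: Liu2021, App. D §D.1 Step 3 (l. 5221)] -/
theorem commute_theta (g : localPi E c N J v) (z : (standingData E v c N J hcδ hδ hN hJh hJdet).normOne) :
    Commute (ω g) ((show Representation ℂ (standingData E v c N J hcδ hδ hN hJh hJdet).normOne V from
      (ω.comp (localCenter E c N J J₁ hJ₁ v)).comp (theta E v c N J hcδ hδ hN hJh hJdet J₁)) z) :=
  hc g (theta E v c N J hcδ hδ hN hJh hJdet J₁ z)

include hc in
/-- the same pair read on `S.U` along `uEquiv`. [cite: Liu2021, App. D §D.1 Step 3 (l. 5221)] -/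
theorem commute_uEquiv_theta (g : (standingData E v c N J hcδ hδ hN hJh hJdet).U)
    (z : (standingData E v c N J hcδ hδ hN hJh hJdet).normOne) :
    Commute ((show Representation ℂ (standingData E v c N J hcδ hδ hN hJh hJdet).U V from
        ω.comp (uEquiv E v c N J hcδ hδ hN hJh hJdet).toMulEquiv.toMonoidHom) g)
      ((show Representation ℂ (standingData E v c N J hcδ hδ hN hJh hJdet).normOne V from
        (ω.comp (localCenter E c N J J₁ hJ₁ v)).comp (theta E v c N J hcδ hδ hN hJh hJdet J₁)) z) :=
  hc (uEquiv E v c N J hcδ hδ hN hJh hJdet g) (theta E v c N J hcδ hδ hN hJh hJdet J₁ z)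

/-- the commuting hypothesis for the datum's own pair `(omega, omega ∘ scalar)` (the scalars are central).
[cite: Liu2021, App. D §D.1 Step 3 (l. 5221)] -/
theorem commute_scalar (g : (standingData E v c N J hcδ hδ hN hJh hJdet).U)
    (z : (standingData E v c N J hcδ hδ hN hJh hJdet).normOne) :
    Commute ((data E v c N J hcδ hδ hN hJh hJdet J₁ ω μ hμn hμc hμF χ hχn hχc).omega g)
      ((show Representation ℂ (standingData E v c N J hcδ hδ hN hJh hJdet).normOne V from
        (data E v c N J hcδ hδ hN hJh hJdet J₁ ω μ hμn hμc hμF χ hχn hχc).omega.comp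
          (standingData E v c N J hcδ hδ hN hJh hJdet).scalar) z) :=
  TwistedCoinv.commute_of_central _ _ (standingData E v c N J hcδ hδ hN hJh hJdet).scalar_mem_center g z

/-- **the two acting pairs agree on `V`**: `ω (localCenter (θ z)) = omega (S.scalar z)` (`localCenter_theta`), in the
shape `mapEquiv` consumes (unit factor `1`, `T = id`). [cite: Liu2021, App. D §D.1 Step 3, arXiv:2102.11518 chunk p0056 L16 (arXiv PDF p. 76)] -/
theorem acting_pairs_agree (z : (standingData E v c N J hcδ hδ hN hJh hJdet).normOne) (x : V) :
    (show Representation ℂ (standingData E v c N J hcδ hδ hN hJh hJdet).normOne V from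
        (ω.comp (localCenter E c N J J₁ hJ₁ v)).comp (theta E v c N J hcδ hδ hN hJh hJdet J₁)) z
        ((LinearEquiv.refl ℂ V) x) =
      (((fun _ => (1 : ℂˣ)) z : ℂˣ) : ℂ) • (LinearEquiv.refl ℂ V)
        ((show Representation ℂ (standingData E v c N J hcδ hδ hN hJh hJdet).normOne V from
          (data E v c N J hcδ hδ hN hJh hJdet J₁ ω μ hμn hμc hμF χ hχn hχc).omega.comp
            (standingData E v c N J hcδ hδ hN hJh hJdet).scalar) z x) := by
  rw [Units.val_one, one_smul, LinearEquiv.refl_apply, LinearEquiv.refl_apply]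
  change ω (localCenter E c N J J₁ hJ₁ v (theta E v c N J hcδ hδ hN hJh hJdet J₁ z)) x =
    ω (uEquiv E v c N J hcδ hδ hN hJh hJdet ((standingData E v c N J hcδ hδ hN hJh hJdet).scalar z)) x
  rw [localCenter_theta]

/-- the two Step-3 characters agree: `chi z = 1 · χ (θ z)`. [cite: Liu2021, App. D §D.1 Step 3, arXiv:2102.11518 chunk p0056 L16 (arXiv PDF p. 76)] -/
theorem chi_agree (z : (standingData E v c N J hcδ hδ hN hJh hJdet).normOne) :
    χ.comp (theta E v c N J hcδ hδ hN hJh hJdet J₁) z =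
      (fun _ => (1 : ℂˣ)) z * (data E v c N J hcδ hδ hN hJh hJdet J₁ ω μ hμn hμc hμF χ hχn hχc).chi z := by
  rw [one_mul]
  rfl

/-- the `S.U`-actions agree along `T = id` (the datum's `omega` versus `ω ∘ uEquiv`, factor `1`).
[cite: Liu2021, App. D §D.1 Steps 1–2, arXiv:2102.11518 chunk p0056 L12–L14 (arXiv PDF p. 76)] -/
theorem omega_agree (g : (standingData E v c N J hcδ hδ hN hJh hJdet).U) (x : V) :
    (show Representation ℂ (standingData E v c N J hcδ hδ hN hJh hJdet).U V from
        ω.comp (uEquiv E v c N J hcδ hδ hN hJh hJdet).toMulEquiv.toMonoidHom) (MonoidHom.id _ g)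
        ((LinearEquiv.refl ℂ V) x) =
      (((fun _ => (1 : ℂˣ)) g : ℂˣ) : ℂ) • (LinearEquiv.refl ℂ V)
        ((data E v c N J hcδ hδ hN hJh hJdet J₁ ω μ hμn hμc hμF χ hχn hχc).omega g x) := by
  rw [Units.val_one, one_smul]
  rfl

/-- **`mapEquiv`: the datum's coinvariants `Coinv (omega ∘ scalar) chi` and the tree's
`Coinv (ω ∘ localCenter ∘ θ) (χ ∘ θ)` are the same quotient of `V`** (identity on `V`).
[cite: Liu2021, App. D §D.1 Step 3, arXiv:2102.11518 chunk p0056 L16 (arXiv PDF p. 76)] -/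
def coinvEquiv :
    TwistedCoinv.Coinv (show Representation ℂ (standingData E v c N J hcδ hδ hN hJh hJdet).normOne V from
        (data E v c N J hcδ hδ hN hJh hJdet J₁ ω μ hμn hμc hμF χ hχn hχc).omega.comp
          (standingData E v c N J hcδ hδ hN hJh hJdet).scalar)
        (data E v c N J hcδ hδ hN hJh hJdet J₁ ω μ hμn hμc hμF χ hχn hχc).chi ≃ₗ[ℂ]
      TwistedCoinv.Coinv (show Representation ℂ (standingData E v c N J hcδ hδ hN hJh hJdet).normOne V from
        (ω.comp (localCenter E c N J J₁ hJ₁ v)).comp (theta E v c N J hcδ hδ hN hJh hJdet J₁))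
        (χ.comp (theta E v c N J hcδ hδ hN hJh hJdet J₁)) :=
  TwistedCoinv.mapEquiv _ _ _ _ (LinearEquiv.refl ℂ V) (fun _ => 1)
    (acting_pairs_agree E v c N J hcδ hδ hN hJh hJdet J₁ ω μ hμn hμc hμF χ hχn hχc hJ₁)
    (chi_agree E v c N J hcδ hδ hN hJh hJdet J₁ ω μ hμn hμc hμF χ hχn hχc)

/-- `coinvEquiv` intertwines the two `S.U`-actions `TwistedCoinv.rep`. [cite: Liu2021, App. D §D.1 Step 3 (l. 5221)] -/
theorem coinvEquiv_rep (g : (standingData E v c N J hcδ hδ hN hJh hJdet).U)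
    (x : TwistedCoinv.Coinv (show Representation ℂ (standingData E v c N J hcδ hδ hN hJh hJdet).normOne V from
        (data E v c N J hcδ hδ hN hJh hJdet J₁ ω μ hμn hμc hμF χ hχn hχc).omega.comp
          (standingData E v c N J hcδ hδ hN hJh hJdet).scalar)
        (data E v c N J hcδ hδ hN hJh hJdet J₁ ω μ hμn hμc hμF χ hχn hχc).chi) :
    coinvEquiv E v c N J hcδ hδ hN hJh hJdet J₁ ω μ hμn hμc hμF χ hχn hχc hJ₁
        (TwistedCoinv.rep _ _ (commute_scalar E v c N J hcδ hδ hN hJh hJdet J₁ ω μ hμn hμc hμF χ hχn hχc) g x) =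
      TwistedCoinv.rep _ _ (commute_uEquiv_theta E v c N J hcδ hδ hN hJh hJdet J₁ ω hJ₁ hc) g
        (coinvEquiv E v c N J hcδ hδ hN hJh hJdet J₁ ω μ hμn hμc hμF χ hχn hχc hJ₁ x) := by
  have h := TwistedCoinv.mapEquiv_rep _ _ _ _ _ _
    (commute_scalar E v c N J hcδ hδ hN hJh hJdet J₁ ω μ hμn hμc hμF χ hχn hχc)
    (commute_uEquiv_theta E v c N J hcδ hδ hN hJh hJdet J₁ ω hJ₁ hc) (LinearEquiv.refl ℂ V) (fun _ => 1)
    (acting_pairs_agree E v c N J hcδ hδ hN hJh hJdet J₁ ω μ hμn hμc hμF χ hχn hχc hJ₁)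
    (chi_agree E v c N J hcδ hδ hN hJh hJdet J₁ ω μ hμn hμc hμF χ hχn hχc) (g := g) (g' := g) (a := (1 : ℂ))
    (fun y => by rw [one_smul]; rfl) x
  rw [one_smul] at h
  exact h.symm

/-- **JUNCTION, irreducibility.**  [Liu2021, App. D, Lemma D.1, first sentence + (1)] AS PRINTED for the datum
`data … ω μ χ` at the place `v` implies, for `N ≥ 3`, that the maximal `χ`-quotient `TwistedCoinv.rep χ ω hc` of `ω`
along the local centre `localCenter : U(J₁)(F_v) →* U(J)(F_v)` is an IRREDUCIBLE representation of
`UnitaryGroup.localPi E c N J v` — the hypothesis `hirr v` of `FinLocalSplittings.omegaPi_centralCoinv_isIrreducible`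
(at `H v = localPi E c 1 J₁ v`, `φ v = localCenter … v`) for `ω = 𝓢.omegaLoc v`. [cite: Liu2021, App. D Lemma D.1 (1), arXiv:2102.11518 chunk p0056 L21–L23 (arXiv PDF p. 76)] -/
theorem isIrreducible_rep_of_lemD1_1AsPrinted
    (hD1 : LemD1_1AsPrinted (data E v c N J hcδ hδ hN hJh hJdet J₁ ω μ hμn hμc hμF χ hχn hχc)) (h3 : 3 ≤ N) :
    (TwistedCoinv.rep χ ω hc).IsIrreducible := by
  -- (0) Lemma D.1 (1) as printed, on the constructed maximal quotient `quotRep` of the datum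
  have hq := hD1.irreducibleAdmissible_quotRep
  have hirr0 := hq.2.1 (hq.2.2 (by omega))
  -- (A) same group `S.U`: `quotRep` is `TwistedCoinv.rep` for the pair `(omega, omega ∘ scalar)`
  have hirrA := (TwistedCoinv.isIrreducible_quotRep_iff _ _
    (standingData E v c N J hcδ hδ hN hJh hJdet).scalar_mem_center _
    (commute_scalar E v c N J hcδ hδ hN hJh hJdet J₁ ω μ hμn hμc hμF χ hχn hχc)).1 hirr0
  -- (B) change of acting pair on `V` (identity of `V`, unit factors `1`): `(ω ∘ uEquiv, ω ∘ localCenter ∘ θ)`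
  have hirrB : (TwistedCoinv.rep (χ.comp (theta E v c N J hcδ hδ hN hJh hJdet J₁))
      (show Representation ℂ (standingData E v c N J hcδ hδ hN hJh hJdet).U V from
        ω.comp (uEquiv E v c N J hcδ hδ hN hJh hJdet).toMulEquiv.toMonoidHom)
      (commute_uEquiv_theta E v c N J hcδ hδ hN hJh hJdet J₁ ω hJ₁ hc)).IsIrreducible :=
    (TwistedCoinv.isIrreducible_rep_iff_of_mapEquiv _ _ _ _ _ _
      (commute_scalar E v c N J hcδ hδ hN hJh hJdet J₁ ω μ hμn hμc hμF χ hχn hχc)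
      (commute_uEquiv_theta E v c N J hcδ hδ hN hJh hJdet J₁ ω hJ₁ hc) (LinearEquiv.refl ℂ V) (fun _ => 1)
      (acting_pairs_agree E v c N J hcδ hδ hN hJh hJdet J₁ ω μ hμn hμc hμF χ hχn hχc hJ₁)
      (chi_agree E v c N J hcδ hδ hN hJh hJdet J₁ ω μ hμn hμc hμF χ hχn hχc) (MonoidHom.id _)
      Function.surjective_id (fun _ => 1)
      (omega_agree E v c N J hcδ hδ hN hJh hJdet J₁ ω μ hμn hμc hμF χ hχn hχc)).1 hirrA
  -- (C) the `G`-action pulled back along the isomorphism `uEquiv : S.U ≃* localPi`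
  have hirrC : (TwistedCoinv.rep (χ.comp (theta E v c N J hcδ hδ hN hJh hJdet J₁)) ω
      (commute_theta E v c N J hcδ hδ hN hJh hJdet J₁ ω hJ₁ hc)).IsIrreducible :=
    (TwistedCoinv.isIrreducible_rep_comp_iff_of_surjective _ _ ω
      (commute_theta E v c N J hcδ hδ hN hJh hJdet J₁ ω hJ₁ hc)
      (uEquiv E v c N J hcδ hδ hN hJh hJdet).toMulEquiv.toMonoidHom (uEquiv E v c N J hcδ hδ hN hJh hJdet).surjective
      (commute_uEquiv_theta E v c N J hcδ hδ hN hJh hJdet J₁ ω hJ₁ hc)).1 hirrB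
  -- (D) the acting centre pulled back along the surjection `θ : E_v¹ ↠ U(J₁)(F_v)`
  exact (TwistedCoinv.isIrreducible_rep_iff_of_comp_surjective_right _ χ
    (theta E v c N J hcδ hδ hN hJh hJdet J₁) (theta_surjective E v c N J hcδ hδ hN hJh hJdet J₁ hJ₁) ω hc
    (commute_theta E v c N J hcδ hδ hN hJh hJdet J₁ ω hJ₁ hc)).1 hirrC

/-- **JUNCTION, admissibility.**  Under the same as-printed hypothesis, `TwistedCoinv.rep χ ω hc` is ADMISSIBLE
(the hypothesis `hadm v` of `FinLocalSplittings.omegaPi_centralCoinv_isIrreducible`). [cite: Liu2021, App. D Lemma D.1 (1), arXiv:2102.11518 chunk p0056 L21–L23 (arXiv PDF p. 76)] -/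
theorem isAdmissible_rep_of_lemD1_1AsPrinted
    (hD1 : LemD1_1AsPrinted (data E v c N J hcδ hδ hN hJh hJdet J₁ ω μ hμn hμc hμF χ hχn hχc)) :
    (TwistedCoinv.rep χ ω hc).IsAdmissible := by
  -- (A) same group `S.U`: `quotRep` is `TwistedCoinv.rep` for the pair `(omega, omega ∘ scalar)`
  have hadmA := (TwistedCoinv.isAdmissible_quotRep_iff _ _
    (standingData E v c N J hcδ hδ hN hJh hJdet).scalar_mem_center _
    (commute_scalar E v c N J hcδ hδ hN hJh hJdet J₁ ω μ hμn hμc hμF χ hχn hχc)).1 hD1.irreducibleAdmissible_quotRep.1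
  -- (B) change of acting pair on `V`, along `coinvEquiv` (equivariant for the `S.U`-actions)
  have hadmB : (TwistedCoinv.rep (χ.comp (theta E v c N J hcδ hδ hN hJh hJdet J₁))
      (show Representation ℂ (standingData E v c N J hcδ hδ hN hJh hJdet).U V from
        ω.comp (uEquiv E v c N J hcδ hδ hN hJh hJdet).toMulEquiv.toMonoidHom)
      (commute_uEquiv_theta E v c N J hcδ hδ hN hJh hJdet J₁ ω hJ₁ hc)).IsAdmissible :=
    (Representation.isAdmissible_iff_of_equivariant _ _
      (coinvEquiv E v c N J hcδ hδ hN hJh hJdet J₁ ω μ hμn hμc hμF χ hχn hχc hJ₁)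
      (coinvEquiv_rep E v c N J hcδ hδ hN hJh hJdet J₁ ω μ hμn hμc hμF χ hχn hχc hJ₁ hc)).1 hadmA
  -- (C) the `G`-action along the topological group isomorphism `uEquiv : S.U ≃ₜ* localPi`
  have hadmC : (TwistedCoinv.rep (χ.comp (theta E v c N J hcδ hδ hN hJh hJdet J₁)) ω
      (commute_theta E v c N J hcδ hδ hN hJh hJdet J₁ ω hJ₁ hc)).IsAdmissible :=
    (isAdmissible_rep_comp_iff_of_continuousMulEquiv _ _ ω
      (commute_theta E v c N J hcδ hδ hN hJh hJdet J₁ ω hJ₁ hc) (uEquiv E v c N J hcδ hδ hN hJh hJdet)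
      (commute_uEquiv_theta E v c N J hcδ hδ hN hJh hJdet J₁ ω hJ₁ hc)).1 hadmB
  -- (D) the acting centre along the surjection `θ`: same relation submodule of `V`
  exact (isAdmissible_rep_iff_of_comp_surjective_right _ χ
    (theta E v c N J hcδ hδ hN hJh hJdet J₁) (theta_surjective E v c N J hcδ hδ hN hJh hJdet J₁ hJ₁) ω hc
    (commute_theta E v c N J hcδ hδ hN hJh hJdet J₁ ω hJ₁ hc)).1 hadmC

/-- **JUNCTION, non-vanishing.**  Under the same as-printed hypothesis and `N ≥ 3` («zero iff … (in particular
`n = 2`) …»), the maximal `χ`-quotient `Coinv (ω ∘ localCenter) χ` of `V` is a non-zero space.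
[cite: Liu2021, App. D Lemma D.1 (1), arXiv:2102.11518 chunk p0056 L21–L23 (arXiv PDF p. 76)] -/
theorem nontrivial_coinv_of_lemD1_1AsPrinted
    (hD1 : LemD1_1AsPrinted (data E v c N J hcδ hδ hN hJh hJdet J₁ ω μ hμn hμc hμF χ hχn hχc)) (h3 : 3 ≤ N) :
    Nontrivial (TwistedCoinv.Coinv
      (show Representation ℂ (localPi E c 1 J₁ v) V from ω.comp (localCenter E c N J J₁ hJ₁ v)) χ) := by
  have hA := (TwistedCoinv.nontrivial_quotRep_iff _ (standingData E v c N J hcδ hδ hN hJh hJdet).scalar _).1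
    (hD1.nontrivial_of_three_le h3)
  have hB := (coinvEquiv E v c N J hcδ hδ hN hJh hJdet J₁ ω μ hμn hμc hμF χ hχn hχc hJ₁).toEquiv.nontrivial_congr.1 hA
  exact (nontrivial_coinv_iff_of_comp_surjective_right _ χ (theta E v c N J hcδ hδ hN hJh hJdet J₁)
    (theta_surjective E v c N J hcδ hδ hN hJh hJdet J₁ hJ₁)).1 hB

end Literature.NumberTheory.Automorphic.Liu2021.LemD1OfPlace

end
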